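import Literature.NumberTheory.EllipticCurves.Kato2004.SemilocalDecompositionProofs
import Mathlib.NumberTheory.LegendreSymbol.QuadraticChar.Basic
import Mathlib.NumberTheory.DirichletCharacter.Basic
import HarnessLib

/-!
# The quadratic character of `𝔽_p`: uniqueness, and the dictionary `ω̃^{(p−1)/2} = (·/p)` with the Teichmüller character

Topic `Literature/NumberTheory/GaussSums`; namespace `Literature.NumberTheory.GaussSums`.  Proved theorems only (no named
fact, no `sorry`, no instance, no notation).

* **`MulChar.eq_quadraticChar_ringHomComp_of_isQuadratic`**: a NONTRIVIAL quadratic multiplicative character of a finite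
  field `F` with values in a nontrivial commutative ring `R` is `quadraticChar F` composed with `ℤ → R` (the squares have
  index `≤ 2` in `Fˣ`: the product of two non-squares is a square);
* **`DirichletCharacter.eq_quadraticChar_ringHomComp_of_isPrimitive`**: a primitive quadratic Dirichlet character of prime
  level `p` is `(·/p)`; values `DirichletCharacter.apply_eq_quadraticChar_of_isPrimitive`;
* **`ofUnitHom_teichmullerChar_pow_half`**: for an odd prime `p` and the Teichmüller character `ω̃ : (ℤ/p)ˣ → ℤ_pˣ`
  (`Literature.…Kato2004.teichmullerChar`), the multiplicative character of `ℤ/p` attached to `ω̃^{(p−1)/2}` takes the value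
  `(w/p) ∈ {0, ±1} ⊂ ℤ_p` at every `w` (Euler's criterion for the reduction, `ω̃(u) ≡ u`, and `±1` are distinct mod `p`).

Consumer: route BSD/TeichmullerTwistDescent, crux K (the dictionary hypothesis `hθχ : ω̃^{(p−1)/2} = χ` of
`Summit.…TeichmullerTwistDescent.CarrierDatum.not_caseOne_of_carrier`).

## References
* S. Lang, *Cyclotomic Fields I and II* (1990), Ch. 1 §2 (the Teichmüller character generates the character group of `𝔽_pˣ`).
  [LangCyclotomic1990]
* K. Ireland, M. Rosen, *A Classical Introduction to Modern Number Theory* (1990), Ch. 5 §1 (Euler's criterion; the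
  quadratic residue character). [IrelandRosen1990]
-/

noncomputable section

namespace Literature.NumberTheory.GaussSums

open Literature.NumberTheory.EllipticCurves (Kato2004.teichmullerChar Kato2004.toZMod_teichmullerChar
  Kato2004.teichmullerChar_pow_sub_one)

/-! ### Uniqueness of the quadratic character -/

/-- A multiplicative character does not vanish at units (nontrivial target). [cite: IrelandRosen1990, Ch. 8 §1] -/
theorem MulChar.apply_ne_zero_of_isUnit {F R : Type*} [CommMonoidWithZero F] [CommMonoidWithZero R] [Nontrivial R]
    (χ : MulChar F R) {b : F} (hb : IsUnit b) : χ b ≠ 0 := by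
  obtain ⟨u, rfl⟩ := hb
  rw [← MulChar.coe_toUnitHom]
  exact (χ.toUnitHom u).ne_zero

/-- A quadratic character takes the value `1` on squares of units. [cite: IrelandRosen1990, Ch. 5 §1] -/
theorem MulChar.apply_mul_self_eq_one_of_isQuadratic {F R : Type*} [CommMonoidWithZero F] [CommRing R] [Nontrivial R]
    {χ : MulChar F R} (hχ : χ.IsQuadratic) {b : F} (hb : IsUnit b) : χ (b * b) = 1 := by
  rw [map_mul]
  rcases hχ b with h | h | h
  · exact absurd h (MulChar.apply_ne_zero_of_isUnit χ hb)
  · rw [h, mul_one]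
  · rw [h]; ring

/-- **Uniqueness of the quadratic character of a finite field**: a nontrivial quadratic multiplicative character `χ` of a
finite field `F` with values in a nontrivial commutative ring is `quadraticChar F` (composed with `ℤ → R`).  (In characteristic
`2` there is no such `χ`; the statement needs no parity hypothesis.) [cite: IrelandRosen1990, Ch. 5 §1; Ch. 8 §1] -/
theorem MulChar.eq_quadraticChar_ringHomComp_of_isQuadratic {F : Type*} [Field F] [Fintype F] [DecidableEq F]
    {R : Type*} [CommRing R] [Nontrivial R] {χ : MulChar F R} (hχ : χ.IsQuadratic) (h1 : χ ≠ 1) :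
    χ = (quadraticChar F).ringHomComp (Int.castRingHom R) := by
  obtain ⟨u₀, hu₀⟩ := MulChar.ne_one_iff.mp h1
  have hu₀' : χ (u₀ : F) = -1 := by
    rcases hχ u₀ with h | h | h
    · exact absurd h (MulChar.apply_ne_zero_of_isUnit χ u₀.isUnit)
    · exact absurd h hu₀
    · exact h
  -- `u₀` is not a square
  have hns : ¬ IsSquare ((u₀ : Fˣ) : F) := by
    rintro ⟨b, hb⟩
    have hbu : IsUnit b := isUnit_of_mul_isUnit_left (hb ▸ u₀.isUnit)
    exact hu₀ (by rw [hb, MulChar.apply_mul_self_eq_one_of_isQuadratic hχ hbu])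
  refine MulChar.ext fun a => ?_
  rw [MulChar.ringHomComp_apply, eq_intCast]
  by_cases hsq : IsSquare ((a : Fˣ) : F)
  · rw [(quadraticChar_one_iff_isSquare a.ne_zero).mpr hsq, Int.cast_one]
    obtain ⟨b, hb⟩ := hsq
    have hbu : IsUnit b := isUnit_of_mul_isUnit_left (hb ▸ a.isUnit)
    rw [hb, MulChar.apply_mul_self_eq_one_of_isQuadratic hχ hbu]
  · rw [quadraticChar_neg_one_iff_not_isSquare.mpr hsq, Int.cast_neg, Int.cast_one]
    -- `a u₀` is a square (product of two non-squares)
    have hsq' : IsSquare (((a * u₀ : Fˣ) : Fˣ) : F) := by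
      rw [← quadraticChar_one_iff_isSquare (a * u₀).ne_zero, Units.val_mul, map_mul,
        quadraticChar_neg_one_iff_not_isSquare.mpr hsq, quadraticChar_neg_one_iff_not_isSquare.mpr hns]
      norm_num
    obtain ⟨b, hb⟩ := hsq'
    have hbu : IsUnit b := isUnit_of_mul_isUnit_left (hb ▸ (a * u₀).isUnit)
    have hab : χ (a : F) * χ (u₀ : F) = 1 := by
      rw [← map_mul, ← Units.val_mul, hb, MulChar.apply_mul_self_eq_one_of_isQuadratic hχ hbu]
    rw [hu₀', mul_neg_one, neg_eq_iff_eq_neg] at hab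
    exact hab

/-- **A primitive quadratic Dirichlet character of prime level `p` is the quadratic residue character `(·/p)`.**
[cite: IrelandRosen1990, Ch. 5 §1; Ch. 8 §1] -/
theorem DirichletCharacter.eq_quadraticChar_ringHomComp_of_isPrimitive {p : ℕ} [hp : Fact p.Prime]
    {R : Type*} [CommRing R] [Nontrivial R] {χ : DirichletCharacter R p} (hχ : χ.IsQuadratic) (hprim : χ.IsPrimitive) :
    χ = (quadraticChar (ZMod p)).ringHomComp (Int.castRingHom R) := by
  haveI : NeZero p := ⟨hp.out.ne_zero⟩
  refine MulChar.eq_quadraticChar_ringHomComp_of_isQuadratic hχ fun h1 => ?_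
  rw [h1, DirichletCharacter.isPrimitive_def, DirichletCharacter.conductor_one] at hprim
  exact hp.out.one_lt.ne hprim

/-- Values: a primitive quadratic `χ` mod `p` satisfies `χ(w) = (w/p)` for every `w ∈ ℤ/p`. [cite: IrelandRosen1990, Ch. 5 §1] -/
theorem DirichletCharacter.apply_eq_quadraticChar_of_isPrimitive {p : ℕ} [Fact p.Prime]
    {R : Type*} [CommRing R] [Nontrivial R] {χ : DirichletCharacter R p} (hχ : χ.IsQuadratic) (hprim : χ.IsPrimitive)
    (w : ZMod p) : χ w = ((quadraticChar (ZMod p) w : ℤ) : R) := by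
  rw [DirichletCharacter.eq_quadraticChar_ringHomComp_of_isPrimitive hχ hprim, MulChar.ringHomComp_apply, eq_intCast]

/-! ### The Teichmüller dictionary `ω̃^{(p−1)/2} = (·/p)` -/

variable (p : ℕ) [hp : Fact p.Prime]

/-- `θ = ω̃^{(p−1)/2}` squares to `1`: `θ(u)·θ(u) = ω̃(u)^{p−1} = 1` (`p` odd). [cite: LangCyclotomic1990, Ch. 1 §2] -/
theorem teichmullerChar_pow_half_mul_self (hp2 : p ≠ 2) (u : (ZMod p)ˣ) :
    (Kato2004.teichmullerChar p ^ ((p - 1) / 2)) u * (Kato2004.teichmullerChar p ^ ((p - 1) / 2)) u = 1 := by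
  rw [MonoidHom.pow_apply, ← pow_add, ← two_mul, Nat.two_mul_div_two_of_even (hp.out.even_sub_one hp2),
    Kato2004.teichmullerChar_pow_sub_one]

/-- Reduction: `ω̃(u)^{(p−1)/2} ≡ u^{(p−1)/2} (mod p)`. [cite: LangCyclotomic1990, Ch. 1 §2] -/
theorem toZMod_teichmullerChar_pow_half (u : (ZMod p)ˣ) :
    PadicInt.toZMod (((Kato2004.teichmullerChar p ^ ((p - 1) / 2)) u : ℤ_[p]ˣ) : ℤ_[p]) = (u : ZMod p) ^ ((p - 1) / 2) := by
  rw [MonoidHom.pow_apply, Units.val_pow_eq_pow_val, map_pow, Kato2004.toZMod_teichmullerChar]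

/-- **`ω̃^{(p−1)/2}` is the quadratic residue character**: for an odd prime `p` and every `w ∈ ℤ/p`, the multiplicative
character of `ℤ/p` attached to `ω̃^{(p−1)/2} : (ℤ/p)ˣ → ℤ_pˣ` takes the value `(w/p) ∈ {0, ±1}` (Euler's criterion).
[cite: LangCyclotomic1990, Ch. 1 §2; IrelandRosen1990, Ch. 5 §1 Prop. 5.1.2] -/
theorem ofUnitHom_teichmullerChar_pow_half (hp2 : p ≠ 2) (w : ZMod p) :
    MulChar.ofUnitHom (Kato2004.teichmullerChar p ^ ((p - 1) / 2)) w = ((quadraticChar (ZMod p) w : ℤ) : ℤ_[p]) := by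
  by_cases hw : IsUnit w
  · obtain ⟨u, rfl⟩ := hw
    haveI : Fact (2 < p) := ⟨lt_of_le_of_ne hp.out.two_le (Ne.symm hp2)⟩
    have hchar : ringChar (ZMod p) ≠ 2 := by rw [ZMod.ringChar_zmod_n]; exact hp2
    have hcard : Fintype.card (ZMod p) / 2 = (p - 1) / 2 := by
      rw [ZMod.card]
      rcases hp.out.eq_two_or_odd with h | h
      · exact absurd h hp2
      · omega
    rw [MulChar.ofUnitHom_coe, quadraticChar_eq_pow_of_char_ne_two hchar u.ne_zero, hcard]
    have hsq := teichmullerChar_pow_half_mul_self p hp2 u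
    rw [← Units.val_eq_one, Units.val_mul] at hsq
    have hred := toZMod_teichmullerChar_pow_half p u
    rcases mul_self_eq_one_iff.mp hsq with h1 | h1
    · rw [h1, map_one] at hred
      rw [h1, if_pos hred.symm, Int.cast_one]
    · rw [h1, map_neg, map_one] at hred
      have hne : ¬ (u : ZMod p) ^ ((p - 1) / 2) = 1 := by rw [← hred]; exact ZMod.neg_one_ne_one
      rw [h1, if_neg hne, Int.cast_neg, Int.cast_one]
  · rw [MulChar.map_nonunit _ hw, MulChar.map_nonunit _ hw, Int.cast_zero]

/-- **The dictionary for a primitive quadratic `χ` mod `p`** (`p` odd, values read in a ring of characteristic `0`):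
if `χ(w) = n ∈ ℤ` then `ω̃^{(p−1)/2}(w) = n` in `ℤ_p`. [cite: LangCyclotomic1990, Ch. 1 §2] -/
theorem ofUnitHom_teichmullerChar_pow_half_eq_of_isPrimitive (hp2 : p ≠ 2) {R : Type*} [CommRing R] [Nontrivial R]
    [CharZero R] {χ : DirichletCharacter R p} (hχ : χ.IsQuadratic) (hprim : χ.IsPrimitive) (w : ZMod p) {n : ℤ}
    (hn : χ w = n) : MulChar.ofUnitHom (Kato2004.teichmullerChar p ^ ((p - 1) / 2)) w = (n : ℤ_[p]) := by
  rw [ofUnitHom_teichmullerChar_pow_half p hp2 w]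
  congr 1
  exact Int.cast_injective ((DirichletCharacter.apply_eq_quadraticChar_of_isPrimitive hχ hprim w).symm.trans hn)

end Literature.NumberTheory.GaussSums
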